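import Literature.MathematicalPhysics.QuantumFieldTheory.Balaban1983to89.B9Eq3153FrakGkBoundSlotDiagonal
import Literature.MathematicalPhysics.QuantumFieldTheory.Balaban1983to89.B9Eq3120DeltaPiPrimeFormDiagonalClosed

/-!
# `Balaban1983to89.B9Eq3153EnergyLettersPiDiagonalClosed` — T. Bałaban, *Propagators for lattice gauge theories in a background field*, Commun. Math. Phys. **99**
# (1985) 389–434 [Balaban1985BackgroundPropagators] (3.122) p. 420, (3.130) p. 421, Thm 3.11 p. 416, (3.153) ∕ Thm 3.13 p. 426: **THE THREE ENERGY LETTERS OF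
# PRINT's OPERATOR `Δ̃_{a,k}(U)` ((3.122), `B9Eq3119DeltaPiTower.laplaceAkPi`) ON THE DIAGONAL WITH ONE `∃ α₀ γ` BEFORE EVERY BINDER — (i) `γ·N₁(x)² ≤ re⟨x, Δ̃x⟩`,
# (ii) `‖R_k(U)(D*_Ux)‖² ≤ 4·re⟨x, Δ̃x⟩`, (iii) `a‖Q_k(U)x‖² ≤ 4·re⟨x, Δ̃x⟩`** — the row OWNER's `B9Eq3153FrakGkBoundSlotDiagonal.exists_energy_letters_slot_diagonal_closed`
# at print's slot with the θ-letter INHABITED by NE9 leaf-02's `B9Eq3120DeltaPiPrimeFormDiagonalClosed` (`θ = θ̄α ≤ γ₁∕2`); the (ii)∕(iii)-completion of the OWNER's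
# `B9Thm311LaplaceAkPiPositiveDiagonal.exists_laplaceAkPi_coercive_diagonal_closed` (which is (i))

statement-level skeleton of published theorems with citation tags; proofs where landed; nothing here is a claim about the Yang–Mills mass gap

PDF held: `paper:balaban1985-cmp99-background-propagators` (journal page = PDF page + 388), pp. 416, 420–421, 426 — through the suppliers' quotations.

CITATION HEADER (lean-in-tree rule 2026-08-18).  Audit cell `pub-balaban`, sub-cell `t4`, NE9 crux team (2): LEAF PROVER 04 (`b2b-balaban-t4-ne9-formalise-leaf-04`
gen 79), (T4)-4a — supplier of the π twin of this lineage's gen-77 `B9Eq3153FrakGkLipschitzEnergyTwoBackgrounds` (the `𝔊̃_k`-row between two backgrounds needs,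
besides the coercivity (i), the structure rows (ii)∕(iii) at print's operator, exactly as the `G₀`-slot file needs `B9Eq3153FrakGkBoundDiagonal.exists_energy_letters_diagonal_closed`).

THE PRINT (verbatim via the suppliers).  p. 420: *«we will prove that this term is a small perturbation of Δ_a, and that the operator G̃ used in the above formula
has all the properties formulated in Theorems 3.3, 3.10, 3.11»*; p. 421: *«G̃ = G₀(I − Δ′_πG₀)⁻¹ (3.130)»*; p. 426 Thm 3.13.

WHAT IS PROVED (sorry-free; proof lane — 0 `def`; [folklore] composition BY NAME + one threshold).
* **`exists_energy_letters_pi_diagonal_closed`** — `∃ α₀ γ > 0` (closed in `(d, a, a′, L, M_φ, M_φ′, r, C_τ, ρ_w)`) before every binder; then on the diagonal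
  `ηL^{n+1} = 1`, `c₀(L^{n+1})^d = c₁`, `|η|^d∕c₀ ≤ ρ_w`, for a background `U` of E162's per-level data with mutually adjoint transporters, `U1`-valued, in the
  windows `‖U(b) − 1‖ ≤ αη`, `‖U(∂p) − 1‖ ≤ αη²`, level profile `ε_j ≤ αr^j` (`j < n+1`), `U1`-valued level averages, `0 ≤ α ≤ α₀`, and ANY positivity witness
  `hpos′` of `Δ′_{a′,k}(U)` (defining `G′_k`), for every `x`: (i) `γ·(‖curl₁x‖² + ‖div₁x‖² + ‖x‖²) ≤ re⟨x, laplaceAkPi … x⟩`;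
  (ii) `‖RofUk … U (covDivL2K … x)‖² ≤ 4·re⟨x, laplaceAkPi … x⟩`; (iii) `a·‖QkW … U … x‖² ≤ 4·re⟨x, laplaceAkPi … x⟩`.
  MECHANISM: `exists_energy_letters_slot_diagonal_closed` at `Δ₁ := piOfUk† ∘ hessOp ∘ piOfUk` (TOKEN-IDENTICAL with `laplaceAkPi`'s slot, so the conclusion is
  `laplaceAkPi` by `rfl`-unfolding) with `θ := θ̄α`, `θ̄` from `exists_form_defect_piOfUk_diagonal_closed`, and `α₀ ≤ γ₁∕(2θ̄)` so that `θ ≤ γ₁∕2`; `γ = γ₁∕2`.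
MODEL ∕ DECLARED READINGS.  Those of the two suppliers (E162's data, `hRS`, `U1`, the two windows, the level profile, the averaged `U1`, `ρ_w`, `hpos′` are HYPOTHESES).
HONEST SCOPE.  [folklore] plumbing; ONE background; the diagonal ONLY; crude constants; no kernel bound, no decay; nothing of [B9] asserted beyond the suppliers.  NOT
summit progress (cell pub-balaban: NE9 NOT PRINTED ∕ NOT PROVED; «NE9 ⇐ the named binders»; row WALLED ON A MODEL (O-NE9-1; NEEDS-COORDINATOR #5 UNRULED); spine
PROVED 0∕9; rung (B)+1 finite T⁴ — NOT infinite volume, NOT mass gap, NOT BetaPertH, NOT Clay).  HONEST DEPENDENCY (cell line): continuum YM on T⁴ ⇐ BetaPertH ∧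
nine spine estimates (0/9 proved); BetaPertH ⇐ (D1) ∧ (D4) ∧ CAP+tail; G-an2-4 gates asym, D1 and NE2/3/4.  NEW file; nothing modified.  Net new unproved facts: 0.
-/

noncomputable section

open scoped InnerProductSpace ComplexConjugate BigOperators

namespace Literature.MathematicalPhysics.QuantumFieldTheory.Balaban1983to89.B9Eq3153EnergyLettersPiDiagonalClosed

open B4Sect5Torus (TSite)
open B9SectCLatticeCarrier (Bond)
open B11Eq103H1Complex (SiteL2K BondL2K covDivL2K)
open B9Eq310HessianOperator (adTransportW hessOp covCurlL2K)
open B9Eq310DeltaPrime (plaqHolU)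
open B9Eq315QTorus (perCfg cornerSite)
open B9Eq315QTower (towerP UlevOf)
open B9Eq326OperatorTower (QkW RofUk)
open B9Eq324DeltaPrimeATower (laplacePrimeAk GpOfUk)
open B9Eq3119DeltaPiTower (piOfUk laplaceAkPi)
open B7Prop1Explicit (U1 Wcx boxVec)
open B9Eq3153FrakGkBoundSlotDiagonal (exists_energy_letters_slot_diagonal_closed)
open B9Eq3120DeltaPiPrimeFormDiagonalClosed (exists_form_defect_piOfUk_diagonal_closed)

variable {d : ℕ} (L : ℕ) [NeZero L] (hL : 1 ≤ L)
  {𝔸 : Type*} [NormedRing 𝔸] [NormedAlgebra ℂ 𝔸] [CompleteSpace 𝔸] [NormOneClass 𝔸] [StarRing 𝔸] [NormedStarGroup 𝔸] [StarModule ℂ 𝔸]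
  {W : Type*} [NormedAddCommGroup W] [InnerProductSpace ℂ W] [FiniteDimensional ℂ W] (φ : W ≃ₗ[ℂ] 𝔸)
  {Mφ Mφ' : ℝ} (hMφ : 0 ≤ Mφ) (hMφ' : 0 ≤ Mφ') (hφ : ∀ w, ‖φ w‖ ≤ Mφ * ‖w‖) (hφ' : ∀ X, ‖φ.symm X‖ ≤ Mφ' * ‖X‖)
  {a : ℝ} (ha : 0 < a) {a' : ℝ} (ha' : 0 < a') {r : ℝ} (hr0 : 0 ≤ r) (hr1 : r < 1)
  (τ : 𝔸 →ₗ[ℂ] ℂ) {Cτ : ℝ} (hτ : ∀ X, ‖τ X‖ ≤ Cτ * ‖X‖) (hCτ : 0 ≤ Cτ) {ρw : ℝ} (hρw : 0 ≤ ρw)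

include hMφ hMφ' hφ hφ' ha ha' hr0 hr1 hτ hCτ hρw

-- deep definitional unfolding `laplaceAkPi` ↦ `laplaceALatticeK … (π†Δπ) …`
set_option maxRecDepth 8192 in
/-- **THE THREE ENERGY LETTERS OF PRINT's `Δ̃_{a,k}(U)` ON THE DIAGONAL** — see the module header: `∃ α₀ γ > 0` before every binder; then for every `x`:
(i) `γ·(‖curl₁x‖² + ‖div₁x‖² + ‖x‖²) ≤ re⟨x, laplaceAkPi … x⟩`; (ii) `‖R_k(U)(D*_Ux)‖² ≤ 4·re⟨x, laplaceAkPi … x⟩`; (iii) `a‖Q_k(U)x‖² ≤ 4·re⟨x, laplaceAkPi … x⟩`. [folklore]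
[cite: Balaban1985BackgroundPropagators, (3.122) p.420, (3.130) p.421, Thm 3.11 p.416, Thm 3.13 p.426] -/
theorem exists_energy_letters_pi_diagonal_closed :
    ∃ α₀ γ : ℝ, 0 < α₀ ∧ 0 < γ ∧ ∀ (n : ℕ) (η : ℝ), η * (L : ℝ) ^ (n + 1) = 1 →
      ∀ (c₀ c₁ : ℝ) [Fact (0 < c₀)] [Fact (0 < c₁)], c₀ * ((L : ℝ) ^ (n + 1)) ^ d = c₁ → |η| ^ d / c₀ ≤ ρw →
      ∀ (m : Fin d → ℕ) [∀ i, NeZero (m i)] (U : Bond d (towerP L m (n + 1)) → 𝔸ˣ) (αU : ℕ → ℝ) (hα1 : ∀ j, αU j ≤ 1 / 64)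
        (hU1 : ∀ (j : ℕ) (x : B7Prop1Explicit.Site d) (κ : Fin d), perCfg (towerP L m (j + 1)) (UlevOf L m (n + 1) U j) x κ ∈ U1 𝔸)
        (hreg : ∀ (j : ℕ) (y : TSite d (towerP L m j)) (κ : Fin d) (r : Fin d → Fin L),
          ‖((Wcx L (perCfg (towerP L m (j + 1)) (UlevOf L m (n + 1) U j)) (cornerSite L y) κ (boxVec L r) : 𝔸ˣ) : 𝔸) - 1‖ ≤ αU j)
        (εU : ℕ → ℝ), (∀ j, 0 ≤ εU j) → (∀ (j : ℕ) (b : Bond d (towerP L m (j + 1))), ‖(UlevOf L m (n + 1) U j b : 𝔸) - 1‖ ≤ εU j) →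
      ∀ {α : ℝ}, 0 ≤ α → α ≤ α₀ →
        (∀ (b : Bond d (towerP L m (n + 1))) (v u : W), ⟪adTransportW φ U b v, u⟫_ℂ = ⟪v, adTransportW φ (fun b => (U b)⁻¹) b u⟫_ℂ) →
        (∀ b, U b ∈ U1 𝔸) → (∀ b, ‖(U b : 𝔸) - 1‖ ≤ α * η) →
        (∀ p : B9SectCLatticeCarrier.Plaq d (towerP L m (n + 1)), ‖(plaqHolU U p : 𝔸) - 1‖ ≤ α * η ^ 2) →
        (∀ j < n + 1, εU j ≤ α * r ^ j) →
        (∀ (j : ℕ) (b : Bond d (towerP L m (j + 1))), UlevOf L m (n + 1) U j b ∈ U1 𝔸) →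
        ∀ (hpos' : ∀ x : SiteL2K ℂ d (towerP L m (n + 1)) c₀ W, x ≠ 0 → 0 < RCLike.re ⟪x, laplacePrimeAk L m n φ η U a' (c₁ := c₁) x⟫_ℂ)
          (x : BondL2K ℂ d (towerP L m (n + 1)) c₀ W),
          γ * (‖covCurlL2K ℂ c₀ ((η : ℂ))⁻¹ (adTransportW φ (fun _ : Bond d (towerP L m (n + 1)) => (1 : 𝔸ˣ))) x‖ ^ 2 +
              ‖covDivL2K ℂ c₀ ((η : ℂ))⁻¹ (adTransportW φ fun _ : Bond d (towerP L m (n + 1)) => (1 : 𝔸ˣ)⁻¹) x‖ ^ 2 + ‖x‖ ^ 2) ≤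
            RCLike.re ⟪x, laplaceAkPi L m n φ τ η U a' hpos' hL αU hα1 hU1 hreg (c₁ := c₁) a x⟫_ℂ ∧
          ‖RofUk L m n φ η U (covDivL2K ℂ c₀ ((η : ℂ))⁻¹ (adTransportW φ fun b => (U b)⁻¹) x)‖ ^ 2 ≤
            4 * RCLike.re ⟪x, laplaceAkPi L m n φ τ η U a' hpos' hL αU hα1 hU1 hreg (c₁ := c₁) a x⟫_ℂ ∧
          a * ‖QkW L m n φ U hL αU hα1 hU1 hreg (c₁ := c₁) x‖ ^ 2 ≤
            4 * RCLike.re ⟪x, laplaceAkPi L m n φ τ η U a' hpos' hL αU hα1 hU1 hreg (c₁ := c₁) a x⟫_ℂ := by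
  obtain ⟨αθ, θb, hαθ, hθb, HΘ⟩ := exists_form_defect_piOfUk_diagonal_closed (d := d) L φ hMφ hMφ' hφ hφ' ha' hr0 hr1 τ hτ hCτ hρw
  obtain ⟨α5, γ5, hα5, hγ5, H5⟩ := exists_energy_letters_slot_diagonal_closed (d := d) L hL φ hMφ hMφ' hφ hφ' ha hr0 hr1 τ hτ hCτ hρw
  obtain ⟨αγ, hαγdef⟩ : ∃ αγ : ℝ, αγ = γ5 / (2 * θb) := ⟨_, rfl⟩
  have hαγ : 0 < αγ := by rw [hαγdef]; positivity
  refine ⟨min (min αθ α5) αγ, γ5 / 2, lt_min (lt_min hαθ hα5) hαγ, by positivity, ?_⟩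
  intro n η hηL c₀ c₁ _ _ hw hρ m _ U αU hα1 hU1 hreg εU hεU hUε α hα0 hαle hRS hUb hUη hpl hεg hUlev hpos' x
  have hαθ' : α ≤ αθ := hαle.trans ((min_le_left _ _).trans (min_le_left _ _))
  have hα5' : α ≤ α5 := hαle.trans ((min_le_left _ _).trans (min_le_right _ _))
  have hαγ' : α ≤ αγ := hαle.trans (min_le_right _ _)
  have hθ := HΘ n η hηL c₀ c₁ hw hρ m U hRS α hα0 hαθ' hUb hUη hpl εU hεU hεg hUε hUlev hpos'
  have hθ0 : 0 ≤ θb * α := mul_nonneg hθb.le hα0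
  have hθ5 : θb * α ≤ γ5 / 2 := by
    have h1 : θb * α ≤ θb * αγ := mul_le_mul_of_nonneg_left hαγ' hθb.le
    have h2 : θb * αγ = γ5 / 2 := by rw [hαγdef]; field_simp
    linarith
  exact H5 n η hηL c₀ c₁ hw hρ m U αU hα1 hU1 hreg εU hεU hUε hα0 hα5' hRS hUb hUη hpl hεg _ hθ0 hθ5 hθ x

end Literature.MathematicalPhysics.QuantumFieldTheory.Balaban1983to89.B9Eq3153EnergyLettersPiDiagonalClosed

end
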